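/-
Copyright (c) 2026 the pub-hodgecm-mathlib formalisation cell (harness21).  Prover seat hodgecm-mathlib-K2E3-p23 (g5), HCML Track B «K2-LIT» ∕ h413
(`stmt-HodgeConjecture-24833`), line `K2_E3_EllipticInputs`, unit U12 «Characters», road «GL-[M6]-sc» (line lead K2E3-p23 (g5), dealer K2E3-plan (g3)),
MEMO «M6sc-BLUEPRINT v4» §1 (ASM): the `hcanc` hypothesis of ★ `nonEllEstimates_of_radius`, packaged Haar-a.e. on `G'`, MODULO the mixed per-point cancellation.  2026-09-04.
-/
import Summits.HodgeConjecture.HodgeConjecture.Theorems.K2E3GL3ModUniformizerNonEllBall               -- ★ p858463 (this seat): representative machinery (`normalForm_smul`, …)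
import Summits.HodgeConjecture.HodgeConjecture.Theorems.K2E3GL3SupercuspOrbitalSliceCancellation  -- ★ p858440 (K2E3-p21 g5): the split per-point `hcanc`
import HarnessLib

/-!
# Road «GL-[M6]-sc», ASM brick: `hcanc` PACKAGED — Haar-a.e. on `G'`, off the elliptic set, for EVERY `n`,
# `∫_{Ω n} θ(z x̄ z⁻¹) dμ'(z) = ∫_{Ω n ∩ Ω (R x̄)} θ(z x̄ z⁻¹) dμ'(z)`, `θ = B u' (ρ · u)`, `R x̄ = (A + 306)·(s₀ + 7 h(x̄) + L(x̄) + 1)` — MODULO the mixed per-point statement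

Cell `pub/hodgecm-mathlib` (D-0151), Track B «K2-LIT», crux H413 = `stmt-HodgeConjecture-24833`, route of record `HCCMUnconditional`.  Lane
`--supports stmt-HodgeConjecture-24833 --as helper`; THEOREMS ONLY (no `def`, no `instance`, no `notation`, no named-fact hypothesis, no `sorry`); count-neutral.

The split half is ★ (K2E3-p21 (g5) `setIntegral_conj_eq_setIntegral_inter_split`, radius `(6s₀+L₀) + 6(1+2s+4(6s₀+L₀)) + s` at a class `mk(y γ y⁻¹)`, `γ` regular
diagonal of depth `L₀`, `𝔅_s(y)`); here it is moved to an a.e. `x̄`: lift with `disc ≠ 0` (★ `ae_exists_mk_eq_discr_ne_zero`), integral representative `g₁ = ϖ^k g`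
(★ B4-0), normal form (★ (N0) + ★ `normalForm_smul`, the elliptic case excluded by ★ `isCompact_centralizer_mk_of_irreducible`), conjugator of height `6h + L₀` from
★ T18-split `exists_adBall_mul_zpowDiagGL_of_adBall_conj`, and `L₀ ≤ 6h + L(x̄)` (★ `le_add_of_pow_eq_of_pow_mul_pow_le`), so that the radius is dominated by the
class function `R x̄ = (A + 306)(s₀ + 7h(x̄) + L(x̄) + 1)` (§1 `setIntegral_eq_inter_of_le`: the localisation is monotone in the radius).  The MIXED half is NOT in the
tree: it enters as the explicit hypothesis `HM` (per-point, at an integral representative in mixed normal form, radius `≤ A(s₀ + h + L₀ + 1)`) — the one brick the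
road still owes (spec = the binder `HM` verbatim).
* §1 `setIntegral_eq_inter_of_le`; §2 **`ae_setIntegral_conj_eq_inter_of_hcancMixed`**.
HONEST LABEL: HC_CM is proved only modulo the 7 printed citations (2 remaining named inputs: hLiu418 = stmt-HodgeConjecture-24832, h413 = stmt-HodgeConjecture-24833) until
rung 0 closes; count-neutral helper, closes no socket; CONDITIONAL on the binder `HM` (mixed per-point cancellation), stated not assumed as a fact.

## References
* [HarishChandra1970] Harish-Chandra (notes by G. van Dijk), *Harmonic Analysis on Reductive p-adic Groups*, LNM 162 (1970), Part VII §2 Theorems 18, 20 pp. 69–70; §3 pp. 71–73.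
-/

set_option autoImplicit false
-- the mandated namespace repeats the single-problem summit's segment (`HodgeConjecture.HodgeConjecture`)
set_option linter.dupNamespace false

noncomputable section

open MeasureTheory Measure Set
open scoped MatrixGroups NNReal ENNReal WithZero
open Literature.NumberTheory.Automorphic Literature.NumberTheory.GaloisRepresentations Literature.NumberTheory.GaloisRepresentations.IsNonarchimedeanLocalField
open Summit.HodgeConjecture.HodgeConjecture.Cruxes.H413.K2E3GL3ModUniformizerNonEllBall
open Summit.HodgeConjecture.HodgeConjecture.Cruxes.H413.K2E3GL3ModUniformizerNonEllBallMixed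
open Summit.HodgeConjecture.HodgeConjecture.Cruxes.H413.K2E3GL3ModUniformizerNonEllBallSplit
open Summit.HodgeConjecture.HodgeConjecture.Cruxes.H413.K2E3GL3TruncatedCharSplitTorusRadius
open Summit.HodgeConjecture.HodgeConjecture.Cruxes.H413.K2E3GL3TruncatedCharMixedTorusRadius
open Summit.HodgeConjecture.HodgeConjecture.Cruxes.H413.K2E3GLnAdHeightBalls
open Summit.HodgeConjecture.HodgeConjecture.Cruxes.H413.K2E3GL3ModUniformizerFundamentalDomain
open Summit.HodgeConjecture.HodgeConjecture.Cruxes.H413.K2E3GL3ModUniformizerSeparableAE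
open Summit.HodgeConjecture.HodgeConjecture.Cruxes.H413.K2E3GL3ModUniformizerCentralizerCompact
open Summit.HodgeConjecture.HodgeConjecture.Cruxes.H413.K2E3GL3CharpolyDiscNullHaar
open Summit.HodgeConjecture.HodgeConjecture.Cruxes.H413.K2E3GL3ModUniformizerBallBoundSplit
open Summit.HodgeConjecture.HodgeConjecture.Cruxes.H413.K2E3GL3SupercuspOrbitalSliceCancellation

namespace Summit.HodgeConjecture.HodgeConjecture.Cruxes.H413.K2E3GL3ModUniformizerNonEllCancellation

/-! ## §1 The localisation is monotone in the radius -/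
section Mono

variable {X : Type*} [TopologicalSpace X] [MeasurableSpace X] (μ : Measure X)

/-- If `∫_{Ω n} ψ = ∫_{Ω n ∩ Ω R₀} ψ` for all `n`, then the same holds with any `R₁ ≥ R₀` in place of `R₀`. [cite: HarishChandra1970, Part VII §3 p. 72] -/
theorem setIntegral_eq_inter_of_le (Ω : CompactExhaustion X) (ψ : X → ℂ) {R₀ R₁ : ℕ} (hR : R₀ ≤ R₁)
    (h : ∀ n : ℕ, ∫ x in Ω n, ψ x ∂μ = ∫ x in Ω n ∩ Ω R₀, ψ x ∂μ) (n : ℕ) :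
    ∫ x in Ω n, ψ x ∂μ = ∫ x in Ω n ∩ Ω R₁, ψ x ∂μ := by
  rcases le_or_gt n R₁ with hn | hn
  · rw [inter_eq_left.2 (Ω.subset hn)]
  · rw [inter_eq_right.2 (Ω.subset hn.le), h n, h R₁, inter_eq_right.2 (Ω.subset (hR.trans hn.le)), inter_eq_right.2 (Ω.subset hR)]

end Mono

/-! ## §2 `hcanc`, packaged modulo the mixed per-point statement -/

variable {F : Type*} [Field F] [Valued F ℤᵐ⁰] [ValuativeRel F] [(Valued.v : Valuation F ℤᵐ⁰).Compatible] [IsNonarchimedeanLocalField F] [CharZero F]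
  [MeasurableSpace F] [BorelSpace F] [MeasurableSpace (GL (Fin 3) F)] [BorelSpace (GL (Fin 3) F)]
  {ϖ : F} (hϖ : Valued.v ϖ = WithZero.exp (-1 : ℤ)) (hϖ0 : ϖ ≠ 0)
  [((Subgroup.zpowers (Units.mk0 ϖ hϖ0)).map (Matrix.GeneralLinearGroup.scalar (Fin 3))).Normal]
  [MeasurableSpace (GL (Fin 3) F ⧸ (Subgroup.zpowers (Units.mk0 ϖ hϖ0)).map (Matrix.GeneralLinearGroup.scalar (Fin 3)))]
  [BorelSpace (GL (Fin 3) F ⧸ (Subgroup.zpowers (Units.mk0 ϖ hϖ0)).map (Matrix.GeneralLinearGroup.scalar (Fin 3)))]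
  {V : Type*} [AddCommGroup V] [Module ℂ V] (ρ : Representation ℂ (GL (Fin 3) F ⧸ (Subgroup.zpowers (Units.mk0 ϖ hϖ0)).map (Matrix.GeneralLinearGroup.scalar (Fin 3))) V)
  (hρ : ρ.IsSmooth) (hsc : ρ.IsSupercuspidal) {B : V →ₗ⋆[ℂ] V →ₗ[ℂ] ℂ}
  (hBinv : ∀ (g : GL (Fin 3) F ⧸ (Subgroup.zpowers (Units.mk0 ϖ hϖ0)).map (Matrix.GeneralLinearGroup.scalar (Fin 3))) (v w : V), B (ρ g v) (ρ g w) = B v w) (u u' : V)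
  (Ω : CompactExhaustion (GL (Fin 3) F ⧸ (Subgroup.zpowers (Units.mk0 ϖ hϖ0)).map (Matrix.GeneralLinearGroup.scalar (Fin 3))))
  (hmem : ∀ (m : ℕ) (g : GL (Fin 3) F),
    (QuotientGroup.mk g : GL (Fin 3) F ⧸ (Subgroup.zpowers (Units.mk0 ϖ hϖ0)).map (Matrix.GeneralLinearGroup.scalar (Fin 3))) ∈ Ω m ↔
      ∀ i j k l, Valued.v (ϖ ^ m * ((g : Matrix (Fin 3) (Fin 3) F) i j * ((g⁻¹ : GL (Fin 3) F) : Matrix (Fin 3) (Fin 3) F) k l)) ≤ 1)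
  (hK : ∀ (m : ℕ) (k : GL (Fin 3) F), k ∈ glInt 3 F → ∀ x : GL (Fin 3) F ⧸ (Subgroup.zpowers (Units.mk0 ϖ hϖ0)).map (Matrix.GeneralLinearGroup.scalar (Fin 3)),
    ((QuotientGroup.mk k : GL (Fin 3) F ⧸ _) * x ∈ Ω m ↔ x ∈ Ω m) ∧ (x * (QuotientGroup.mk k : GL (Fin 3) F ⧸ _) ∈ Ω m ↔ x ∈ Ω m))
  (μ' : Measure (GL (Fin 3) F ⧸ (Subgroup.zpowers (Units.mk0 ϖ hϖ0)).map (Matrix.GeneralLinearGroup.scalar (Fin 3)))) [μ'.IsHaarMeasure]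

include hϖ hρ hsc hBinv hmem hK in
/-- **`hcanc` PACKAGED (modulo the mixed per-point statement `HM`).**  `θ = B u' (ρ · u)` supported in `Ω s₀`; coordinates `h`, `δ`, `L` as in ★ `exists_coordinates`;
`A` the mixed radius constant.  Then for every `n`, for `μ'`-a.e. `x̄` with non-compact centraliser,
`∫_{Ω n} θ(z x̄ z⁻¹) dμ'(z) = ∫_{Ω n ∩ Ω ((A + 306)(s₀ + 7 h x̄ + L x̄ + 1))} θ(z x̄ z⁻¹) dμ'(z)`.
[cite: HarishChandra1970, Part VII §2 Theorems 18, 20 pp. 69–70; §3 pp. 71–73] -/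
theorem ae_setIntegral_conj_eq_inter_of_hcancMixed {s₀ : ℕ}
    (hθ : ∀ g : GL (Fin 3) F ⧸ (Subgroup.zpowers (Units.mk0 ϖ hϖ0)).map (Matrix.GeneralLinearGroup.scalar (Fin 3)), B u' (ρ g u) ≠ 0 → g ∈ Ω s₀)
    (hgt : GL (Fin 3) F ⧸ (Subgroup.zpowers (Units.mk0 ϖ hϖ0)).map (Matrix.GeneralLinearGroup.scalar (Fin 3)) → ℕ)
    (δ : GL (Fin 3) F ⧸ (Subgroup.zpowers (Units.mk0 ϖ hϖ0)).map (Matrix.GeneralLinearGroup.scalar (Fin 3)) → ℝ≥0)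
    (L : GL (Fin 3) F ⧸ (Subgroup.zpowers (Units.mk0 ϖ hϖ0)).map (Matrix.GeneralLinearGroup.scalar (Fin 3)) → ℕ)
    (hhgt : ∀ x, x ∈ Ω (hgt x))
    (hδ : ∀ g : GL (Fin 3) F, δ (QuotientGroup.mk g) =
      normAbs F ((g : Matrix (Fin 3) (Fin 3) F)).charpoly.discr / normAbs F ((g : Matrix (Fin 3) (Fin 3) F)).det ^ 2)
    (hL : ∀ x, δ x ≠ 0 → ((residueFieldCard F : ℝ≥0)⁻¹) ^ (L x) ≤ δ x) (A : ℕ)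
    (HM : ∀ (g₁ y : GL (Fin 3) F) (e : Fin 5 → F) (h L₀ : ℕ),
      Irreducible ((!![e 0, e 1; e 2, e 3] : Matrix (Fin 2) (Fin 2) F)).charpoly →
      (g₁ : Matrix (Fin 3) (Fin 3) F) = (y : Matrix (Fin 3) (Fin 3) F) * !![e 0, e 1, 0; e 2, e 3, 0; 0, 0, e 4] * ((y⁻¹ : GL (Fin 3) F) : Matrix (Fin 3) (Fin 3) F) →
      (∀ i j, Valued.v ((g₁ : Matrix (Fin 3) (Fin 3) F) i j) ≤ 1) → (∀ i j, Valued.v (ϖ ^ h * ((g₁⁻¹ : GL (Fin 3) F) : Matrix (Fin 3) (Fin 3) F) i j) ≤ 1) →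
      Valued.v ((g₁ : Matrix (Fin 3) (Fin 3) F)).charpoly.discr = WithZero.exp (-(L₀ : ℤ)) →
      ∃ R₀ : ℕ, R₀ ≤ A * (s₀ + h + L₀ + 1) ∧ ∀ n : ℕ,
        ∫ z in Ω n, B u' (ρ (z * QuotientGroup.mk g₁ * z⁻¹) u) ∂μ' = ∫ z in Ω n ∩ Ω R₀, B u' (ρ (z * QuotientGroup.mk g₁ * z⁻¹) u) ∂μ')
    (n : ℕ) :
    ∀ᵐ x ∂μ', ¬ IsCompact ((Subgroup.centralizer {x} :
          Subgroup (GL (Fin 3) F ⧸ (Subgroup.zpowers (Units.mk0 ϖ hϖ0)).map (Matrix.GeneralLinearGroup.scalar (Fin 3)))) :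
        Set (GL (Fin 3) F ⧸ (Subgroup.zpowers (Units.mk0 ϖ hϖ0)).map (Matrix.GeneralLinearGroup.scalar (Fin 3)))) →
      ∫ z in Ω n, B u' (ρ (z * x * z⁻¹) u) ∂μ' = ∫ z in Ω n ∩ Ω ((A + 306) * (s₀ + 7 * hgt x + L x + 1)), B u' (ρ (z * x * z⁻¹) u) ∂μ' := by
  filter_upwards [ae_exists_mk_eq_discr_ne_zero hϖ hϖ0 μ'] with x hx hnc
  obtain ⟨g, rfl, hD⟩ := hx
  -- the height and the integral representative `g₁ = ϖ^k g`
  set h : ℕ := hgt (QuotientGroup.mk g) with hhdef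
  have hball : ∀ i j k l, Valued.v (ϖ ^ h * ((g : Matrix (Fin 3) (Fin 3) F) i j * ((g⁻¹ : GL (Fin 3) F) : Matrix (Fin 3) (Fin 3) F) k l)) ≤ 1 :=
    (hmem h g).1 (hhgt _)
  obtain ⟨k, hint, hinv⟩ := exists_zpow_scalar_mul_integral_of_adBall hϖ hϖ0 hball
  set g₁ : GL (Fin 3) F := Matrix.GeneralLinearGroup.scalar (Fin 3) (Units.mk0 ϖ hϖ0 ^ k) * g with hg₁def
  have hmk : (QuotientGroup.mk g₁ : GL (Fin 3) F ⧸ (Subgroup.zpowers (Units.mk0 ϖ hϖ0)).map (Matrix.GeneralLinearGroup.scalar (Fin 3))) =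
      QuotientGroup.mk g := mk_scalar_zpow_mul hϖ0 k g
  have hu : ((Units.mk0 ϖ hϖ0 ^ k : Fˣ) : F) ≠ 0 := (Units.mk0 ϖ hϖ0 ^ k).ne_zero
  have hcoe : (g₁ : Matrix (Fin 3) (Fin 3) F) = ((Units.mk0 ϖ hϖ0 ^ k : Fˣ) : F) • (g : Matrix (Fin 3) (Fin 3) F) := coe_scalar_mul _ _
  have hnf₁ : (∃ (y : GL (Fin 3) F) (d : Fin 3 → F), Function.Injective d ∧
        (g₁ : Matrix (Fin 3) (Fin 3) F) = (y : Matrix (Fin 3) (Fin 3) F) * Matrix.diagonal d * ((y⁻¹ : GL (Fin 3) F) : Matrix (Fin 3) (Fin 3) F)) ∨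
      (∃ (y : GL (Fin 3) F) (m : Fin 5 → F), Irreducible ((!![m 0, m 1; m 2, m 3] : Matrix (Fin 2) (Fin 2) F)).charpoly ∧
        (g₁ : Matrix (Fin 3) (Fin 3) F) =
          (y : Matrix (Fin 3) (Fin 3) F) * !![m 0, m 1, 0; m 2, m 3, 0; 0, 0, m 4] * ((y⁻¹ : GL (Fin 3) F) : Matrix (Fin 3) (Fin 3) F)) := by
    rw [hcoe]
    refine normalForm_smul hu ?_
    rcases normalForm_of_discr_ne_zero _ hD with h' | h' | h'
    · exact Or.inl h'
    · exact Or.inr h'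
    · exact absurd (isCompact_centralizer_mk_of_irreducible hϖ hϖ0 g h') hnc
  -- `δ x̄ = ‖disc χ_{g₁}‖ ∕ ‖det g₁‖²`, nonzero; the depth exponent `L₀ ≤ 6h + L x̄`
  have hdet0 : ((g₁ : Matrix (Fin 3) (Fin 3) F)).det ≠ 0 := ((Matrix.isUnit_iff_isUnit_det _).1 (Units.isUnit g₁)).ne_zero
  have hdetg0 : ((g : Matrix (Fin 3) (Fin 3) F)).det ≠ 0 := ((Matrix.isUnit_iff_isUnit_det _).1 (Units.isUnit g)).ne_zero
  have hδx : δ (QuotientGroup.mk g) = normAbs F ((g₁ : Matrix (Fin 3) (Fin 3) F)).charpoly.discr / normAbs F ((g₁ : Matrix (Fin 3) (Fin 3) F)).det ^ 2 := by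
    rw [← hmk]; exact hδ g₁
  have hδ0 : δ (QuotientGroup.mk g) ≠ 0 := by
    rw [hδ g]
    exact div_ne_zero ((_root_.map_ne_zero _).2 hD) (pow_ne_zero _ ((_root_.map_ne_zero _).2 hdetg0))
  have ha0 : normAbs F ((g₁ : Matrix (Fin 3) (Fin 3) F)).det ≠ 0 := (_root_.map_ne_zero _).2 hdet0
  have hDeq : normAbs F ((g₁ : Matrix (Fin 3) (Fin 3) F)).charpoly.discr = δ (QuotientGroup.mk g) * normAbs F ((g₁ : Matrix (Fin 3) (Fin 3) F)).det ^ 2 := by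
    rw [hδx, div_mul_cancel₀ _ (pow_ne_zero _ ha0)]
  have hdisc0 : ((g₁ : Matrix (Fin 3) (Fin 3) F)).charpoly.discr ≠ 0 := by
    intro h0; apply hδ0; rw [hδx, h0, map_zero, zero_div]
  obtain ⟨L₀, hL₀⟩ := exists_nat_v_eq_exp_neg hdisc0 (v_discr_charpoly_le_one_of_normalForm hnf₁ hint)
  have hq : normAbs F ϖ = (residueFieldCard F : ℝ≥0)⁻¹ := normAbs_uniformizer_eq_inv hϖ
  have hs0 : (0 : ℝ≥0) < (residueFieldCard F : ℝ≥0)⁻¹ := inv_residueFieldCard_pos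
  have hs1 : (residueFieldCard F : ℝ≥0)⁻¹ < 1 := inv_residueFieldCard_lt_one
  have hdet : ((residueFieldCard F : ℝ≥0)⁻¹) ^ (3 * h) ≤ normAbs F ((g₁ : Matrix (Fin 3) (Fin 3) F)).det := by
    have hv := v_pow_pow_three_le_v_det (y := g₁) hinv
    have hn : normAbs F ((ϖ ^ h) ^ 3) ≤ normAbs F ((g₁ : Matrix (Fin 3) (Fin 3) F)).det :=
      normAbs_le_normAbs_iff.2 ((v_le_iff_valuation_le _ _).1 hv)
    rwa [map_pow, map_pow, hq, ← pow_mul, mul_comm] at hn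
  have hϖL : Valued.v (ϖ ^ L₀) = WithZero.exp (-(L₀ : ℤ)) := by
    rw [map_pow, hϖ, ← WithZero.exp_nsmul]; congr 1; simp
  have hDL : ((residueFieldCard F : ℝ≥0)⁻¹) ^ L₀ = normAbs F ((g₁ : Matrix (Fin 3) (Fin 3) F)).charpoly.discr := by
    have hv : Valued.v ((g₁ : Matrix (Fin 3) (Fin 3) F)).charpoly.discr = Valued.v (ϖ ^ L₀) := by rw [hL₀, hϖL]
    have h1 := normAbs_le_normAbs_iff.2 ((v_le_iff_valuation_le _ _).1 hv.le)
    have h2' := normAbs_le_normAbs_iff.2 ((v_le_iff_valuation_le _ _).1 hv.ge)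
    rw [map_pow, hq] at h1 h2'
    exact le_antisymm h2' h1
  have hLle : L₀ ≤ L (QuotientGroup.mk g) + 2 * (3 * h) :=
    le_add_of_pow_eq_of_pow_mul_pow_le hs0 hs1 (hDL.trans hDeq) (hL _ hδ0) hdet
  -- the two cases
  rcases hnf₁ with ⟨y, d, hd, hg⟩ | ⟨y, e, hirr, hg⟩
  · -- SPLIT: regular diagonal `γ = diag d` with integral eigenvalues, conjugator of height `6h + L₀` (★ T18-split), then ★ (C-shell B) FILE 2
    obtain ⟨hd0, hg'⟩ := exists_glDiagonal_conj_eq hg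
    set t : Fin 3 → Fˣ := fun i => Units.mk0 (d i) (hd0 i) with ht
    have htd : ((glDiagonal 3 F t : GL (Fin 3) F) : Matrix (Fin 3) (Fin 3) F) = Matrix.diagonal d := by
      rw [coe_glDiagonal]; exact congrArg Matrix.diagonal (funext fun i => rfl)
    have hy : ∀ i j, Valued.v ((((y * glDiagonal 3 F t * y⁻¹ : GL (Fin 3) F)) : Matrix (Fin 3) (Fin 3) F) i j) ≤ 1 := by rw [← hg']; exact hint
    have ht1 : ∀ i, Valued.v (d i) ≤ 1 := fun i => v_eigenvalue_le_one_of_conj htd hy i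
    have hs : ∀ i j k' l, Valued.v (ϖ ^ h * (((y * glDiagonal 3 F t * y⁻¹ : GL (Fin 3) F) : Matrix (Fin 3) (Fin 3) F) i j *
        (((y * glDiagonal 3 F t * y⁻¹)⁻¹ : GL (Fin 3) F) : Matrix (Fin 3) (Fin 3) F) k' l)) ≤ 1 := by
      rw [← hg']; exact adBall_of_integral_of_inv hint hinv
    have hdisc : ((g₁ : Matrix (Fin 3) (Fin 3) F)).charpoly.discr = ((d 0 - d 1) * (d 0 - d 2) * (d 1 - d 2)) ^ 2 := by
      rw [hg, Matrix.coe_units_inv, Matrix.charpoly_units_conj, K2E3SplitTorusDepthFromDiscriminant.charpoly_discr_diagonal_fin_three]; ring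
    have hDd : Valued.v (ϖ ^ L₀ * (d 0 * d 1 * d 2) ^ 2) ≤ Valued.v (((d 0 - d 1) * (d 0 - d 2) * (d 1 - d 2)) ^ 2) := by
      rw [map_mul, hϖL, ← hdisc, hL₀]
      refine mul_le_of_le_one_right zero_le ?_
      rw [map_pow, map_mul, map_mul]
      exact pow_le_one₀ zero_le (mul_le_one' (mul_le_one' (ht1 0) (ht1 1)) (ht1 2))
    obtain ⟨ev, hev⟩ := exists_adBall_mul_zpowDiagGL_of_adBall_conj hϖ hϖ0 htd hs hDd
    have hconj : (y * zpowDiagGL (n := 3) hϖ0 ev) * glDiagonal 3 F t * (y * zpowDiagGL (n := 3) hϖ0 ev)⁻¹ = g₁ := by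
      rw [mul_zpowDiagGL_conj_glDiagonal hϖ0 y t ev, ← hg']
    have key := setIntegral_conj_eq_setIntegral_inter_split hϖ hϖ0 ρ hρ hsc hBinv u u' Ω hmem hK μ' hθ htd hd hDd hev
    rw [hconj, hmk] at key
    refine setIntegral_eq_inter_of_le μ' Ω _ ?_ key n
    have h6 : 6 * h + L₀ ≤ 12 * h + L (QuotientGroup.mk g) := by omega
    nlinarith [h6, hLle, Nat.zero_le s₀, Nat.zero_le A, Nat.zero_le h, Nat.zero_le (L (QuotientGroup.mk g))]
  · -- MIXED: the hypothesis `HM`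
    obtain ⟨R₀, hR₀, key⟩ := HM g₁ y e h L₀ hirr hg hint hinv hL₀
    rw [hmk] at key
    refine setIntegral_eq_inter_of_le μ' Ω _ (hR₀.trans ?_) key n
    have h7 : s₀ + h + L₀ + 1 ≤ s₀ + 7 * h + L (QuotientGroup.mk g) + 1 := by omega
    calc A * (s₀ + h + L₀ + 1) ≤ A * (s₀ + 7 * h + L (QuotientGroup.mk g) + 1) := Nat.mul_le_mul_left _ h7
      _ ≤ (A + 306) * (s₀ + 7 * h + L (QuotientGroup.mk g) + 1) := Nat.mul_le_mul_right _ (Nat.le_add_right _ _)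

end Summit.HodgeConjecture.HodgeConjecture.Cruxes.H413.K2E3GL3ModUniformizerNonEllCancellation

end
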